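import Summits.ResolutionOfSingularities.ResolutionOfSingularities.Theorems.NearCutForms2
import HarnessLib

/-!
# NearCutPort — decomp-res node «NearCut» (lens-3 g22, critic row 170), tree file 3/10 of the node

Content VERBATIM from the decomp-res lens-3 g22 node `HOME/decomp-res-lens-3/g22/NearCut.lean` (pin 52e91527; HOME =
run/shared/lean/pub/decomp-res); critic row 170
BOOKED 0·0; landing orders INBOX :715 / :727 — provenance, critic text and the lens header in full in the first file
of the node, `NearCutForms`.  Namespace
`…Theorems.NearCut`; `--supports stmt-ResolutionOfSingularities-31770`; linear import chain in the lens's order.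

## This file

§N2 THE NEAR-CHAIN PORT and the named pieces — DEFINITIONS / HYPOTHESES ONLY, NOTHING ASSERTED (critic row 170):
`multIdeal`, `IsolatedMult`, the port statement `NearChainPort` (Cossart–Jannsen–Saito LNM 2270 Thm 5.40 with `B =
∅`: a `Prop` DEFINED here, used only as a hypothesis; it becomes a Literature PORT item only after lens-3 confirms
the column's one port slot), the aside class `NoBalancedTailsDeep`, the strip / companion data, `CompanionLaw`,
`SheddingLemma`, and the composed skeleton `noBalancedTails_of_pieces` (PORT + COMPANION LAW + DIRECTRIX LAW +
SHEDDING ⟹ the class; sections `Port`, `Classes`, `Companion`, `Pieces`, `Skeleton`).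

[WRITER NOTE (decomp-res writer g10): file split only (tree files ≤ 400 lines); namespace blocks, sections, section
variables, `open` lines and every declaration
exactly as in the lens; the three deprecated `Finsupp.degree_add` occurrences read `map_add` (definitionally the same lemma).]

(Sources: cossart2020 (Cossart–Jannsen–Saito LNM 2270: Thm 5.40 p. 85, Defs 5.38/5.39 pp. 84–85, Thm 5.28 p. 72, Thm
5.35 / Cor 5.37); HauserPerlega2024 (Prop. 3 p. 791); Hauser2010Kangaroo (arXiv:0811.4151); Moh1987;
CossartPiltant2008 §2; Giraud1975; Hironaka1964.)
-/

noncomputable section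

open MvPolynomial Finset
open Literature.AlgebraicGeometry.Resolution
open Literature.AlgebraicGeometry.Resolution.Hauser2010
open Literature.AlgebraicGeometry.Resolution.PointBlowup
open Summit.ResolutionOfSingularities.ResolutionOfSingularities.Theses
open Summit.ResolutionOfSingularities.ResolutionOfSingularities.Theorems.TightDefectClasses
open Summit.ResolutionOfSingularities.ResolutionOfSingularities.Theorems.TightDefectStrongWalks
open Summit.ResolutionOfSingularities.ResolutionOfSingularities.Theorems.ItineraryCutClasses
open Summit.ResolutionOfSingularities.ResolutionOfSingularities.Theorems.BoundaryLedger
open Summit.ResolutionOfSingularities.ResolutionOfSingularities.Theorems.ProximityCut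
open Summit.ResolutionOfSingularities.ResolutionOfSingularities.Theorems.ConeCutAxisLaw
open Literature.AlgebraicGeometry.Resolution.WeightedBlowup
open Literature.Barriers.ResolutionOfSingularities
open Summit.ResolutionOfSingularities.ResolutionOfSingularities.Theorems.FloorCut
open Summit.ResolutionOfSingularities.ResolutionOfSingularities.Theorems.ConeCut
open Summit.ResolutionOfSingularities.ResolutionOfSingularities.Theorems.ExitLaw (fin3_cases eq_of_le_of_degree_le)
open Summit.ResolutionOfSingularities.ResolutionOfSingularities.Theorems.ShadeCut
open Summit.ResolutionOfSingularities.ResolutionOfSingularities.Theorems.TightCut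
open Summit.ResolutionOfSingularities.ResolutionOfSingularities.Theorems.HoleCut

namespace Summit.ResolutionOfSingularities.ResolutionOfSingularities.Theorems.NearCut

section Port

variable {K : Type} [Field K]

/-! ## §N2 THE NEAR-CHAIN PORT (the ONE printed theorem: Cossart–Jannsen–Saito, Thm 5.40 with `B = ∅`, chain of
length-one fundamental units), the COMPANION CHAIN of a balanced tail, the two DICTIONARY PIECES, and the COMPOSED
SKELETON `NearChainPort → CompanionLaw → SheddingLemma → NoBalancedTailsDeep` (kernel-checked, 0 sorry). -/

/-- The MULTIPLICITY-`s` IDEAL of `G`: `(∂^{(d)} G : |d| < s)` over the tree's Hasse–Schmidt derivatives — its zero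
set is the locus of points of multiplicity `≥ s` of the hypersurface `{G = 0} ⊂ 𝔸³` (order criterion with
Hasse–Schmidt derivations, every characteristic).  DEFINITION (support).
(Sources: Kawanoue–Matsuki, arXiv:math/0607009, Lemma 1.2.3.1 (p. 45): `ord_P(I) ≥ n ⟺ P ∈ V(Diff^{n-1} I)`, the
differential operators of order `< n` on the polynomial ring being generated by the Hasse–Schmidt derivatives
`∂^{(d)}`, `|d| < n` (EGA IV §16.11); CJS LNM 2270 Ch. 2: for a hypersurface the Hilbert–Samuel stratum is the
multiplicity stratum.) -/
noncomputable def multIdeal (s : ℕ) (G : MvPolynomial (Fin 3) K) : Ideal (MvPolynomial (Fin 3) K) :=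
  Ideal.span ((fun d => hasseDeriv K d G) '' {d : Fin 3 →₀ ℕ | d.degree < s})

/-- `IsolatedMult s G`: the origin is an ISOLATED point of the multiplicity-`s` locus of `{G = 0} ⊂ 𝔸³_K` — some `g`
with `g(0) ≠ 0` multiplies a power of every variable into the multiplicity ideal (same certificate shape as the
tree's `IsolatedTop`).  For the surface `S = {G = 0}` with `ord₀ G = s = max mult`, this says: the closed point is
isolated in its Hilbert–Samuel (= multiplicity) stratum `S_max`, hence NO REGULAR CURVE `C ⊆ S_max` passes through
it.  DEFINITION (support). -/
def IsolatedMult (s : ℕ) (G : MvPolynomial (Fin 3) K) : Prop :=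
  ∃ (M : ℕ) (g : MvPolynomial (Fin 3) K), constantCoeff g ≠ 0 ∧ ∀ i : Fin 3, g * X i ^ M ∈ multIdeal s G

end Port

/-- **THE NEAR-CHAIN PORT** — the ONE printed theorem of this node, typed in the tree's own objects
(`chartTransform`, `translate`, `ordZero`, `homogeneousComponent`, `hasseDeriv`):  there is NO infinite chain
`G_0, G_1, …` of surface equations in `𝔸³_K` (any field `K`, any characteristic) such that
(N-rec) `G_{n+1} = G_n(…, y_i y_j + b_i y_j, …, y_j, …)/y_j^s` is the strict transform of `G_n` under the blow-up of
        the origin, read at the `K`-rational point `b_n` of the `y_{j_n}`-chart of the exceptional plane (`b_n(j_n) = 0`);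
(N-near) every `G_n` has multiplicity exactly `s ≥ 2` at the origin (`x_{n+1}` is NEAR / infinitely near to `x_n`);
(N-dir) every tangent cone is an `s`-fold PLANE: `in_s(G_n) = c · ℓ_n^s`, `ℓ_n` linear (`e(x_n) = ē(x_n) = 2`);
(N-iso) the origin is ISOLATED in the multiplicity-`s` locus of `{G_n = 0}` (so no regular curve of `S_max` passes).
PRINTED SOURCE: Cossart–Jannsen–Saito, *Desingularization: invariants and strategy*, LNM 2270 (2020) = arXiv:0905.2191v2,
**Theorem 5.40** (p. 85: for the canonical sequence of `B`-permissible blow-ups of an excellent two-dimensional `X`,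
there is no infinite chain of fundamental units of length one `x_0 ← x_1 ← …`, i.e. (Def. 5.38/5.39, length-one
convention p. 85) point blow-ups with `x_{n+1}` near `x_n`, `e^O(x_n) = e(x_n) = ē(x_n) = 2` and no `B`-permissible
regular curve through `x_n` in `X_max`), applied with `B = ∅` (then `O(x) = ∅`, `e^O = e`, Rem. after Def. 5.34) to
the local surface `X = Spec O_{𝔸³,0}/(G_0)` (excellent, dimension two, possibly non-reduced — CJS p. 4 allow it).
READING N1–N6 (standard, see NODE-g22.md §2): HS-stratum of a hypersurface = multiplicity stratum; `Bl` in the chart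
= `chartTransform s`; near ⟺ multiplicity stays `s`; `e = ē = 2` ⟸ `in_s = c·ℓ^s`; isolation ⟹ no regular curve in
`X_max` through `x_n` ⟹ the canonical step at `x_n` is the point blow-up; `K`-rational centres are the `k(x')=k(x)`
case of Thm 5.35/Def. 5.38.  NAMED, UNPROVED HERE (the EQUIV of lens-3 g22). (Sources: cossart2020, Thm 5.40.) -/
def NearChainPort : Prop :=
  ∀ (K : Type) [Field K] (s : ℕ), 2 ≤ s →
    ∀ (G : ℕ → MvPolynomial (Fin 3) K) (j : ℕ → Fin 3) (b : ℕ → Fin 3 → K),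
      (∀ n, b n (j n) = 0) →
      (∀ n, G (n + 1) = translate (b n) (chartTransform s (j n) (G n))) →
      (∀ n, ordZero (G n) = (s : ℕ∞)) →
      (∀ n, ∃ (c : K) (ℓ : MvPolynomial (Fin 3) K), c ≠ 0 ∧ ℓ.IsHomogeneous 1 ∧ ℓ ≠ 0 ∧
        homogeneousComponent s (G n) = C c * ℓ ^ s) →
      (∀ n, IsolatedMult s (G n)) → False

section Classes

/-- **THE BALANCED-TAIL CLASS (general form)**: no forced walk from a root carries an infinite plateau (constant
shade `s ≥ 2`, orders `≠ p^e`) with recurring proximity repeats whose every stage is δ-BALANCED —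
`|r_t| + 2s = 2p^e` and `r_t ∈ perm(0, p^e − s, p^e − s)`.  By §W1 (g21, WALL LAW) every strict small-dead skew joint
tail without total losses is of this form; the three booked balanced residual classes of g20/g21
(`NoBalancedBoundaryTailsDeep`, `NoTameBalancedStrictTailsDeep`, `NoWildBalancedStrictTailsDeep`) are this class with
MORE binders (§N3).  DEFINITION (new typed class). -/
def NoBalancedTailsDeep : Prop :=
  ∀ p : ℕ, p.Prime → ∀ e : ℕ, 2 ≤ e →
    ∀ (K : Type) [Field K] [CharP K p] [PerfectField K] [DecidableEq K] (s₀ : State (Fin 3) K),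
      IsRoot (p ^ e) s₀ → ∀ W : ForcedWalk (p ^ e) s₀, ∀ N : ℕ,
      (∀ t, N ≤ t → (W.st (t + 1)).shade = (W.st t).shade) →
      (∀ t, N ≤ t → ordZero (W.st t).F ≠ ((p ^ e : ℕ) : ℕ∞)) →
      (∀ M : ℕ, ∃ t, M ≤ t ∧ StaysOnNewest W t) →
      ∀ s : ℕ, (W.st N).shade = (s : ℕ∞) → 2 ≤ s →
      (∀ t, N ≤ t → ((W.st t).r.degree + 2 * s = 2 * p ^ e ∧
        ∃ x, (W.st t).r x = 0 ∧ ∀ y, y ≠ x → (W.st t).r y + s = p ^ e)) → False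

end Classes

section Companion

variable {K : Type} [Field K] [DecidableEq K] {q : ℕ} {s₀ : State (Fin 3) K}

/-- The boundary-stripped equation of a state: `F / y^r` (term by term).  DEFINITION (support). -/
def strip (st : State (Fin 3) K) : MvPolynomial (Fin 3) K :=
  ∑ d ∈ st.F.support, monomial (d - st.r) (coeff d st.F)

/-- **THE COMPANION CHAIN** of a walk from stage `N` at multiplicity `s`: `G_0 = F_N / y^{r_N}` (the strict transform
of the original surface germ … no: simply the boundary-stripped residual equation AT STAGE `N`, taken as a NEW surface
`S = {G_0 = 0} ⊂ 𝔸³`), and `G_{n+1} =` the strict transform of `G_n` (multiplicity `s`) under the walk's own move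
`N + n` (same chart, same point).  No cleaning, no boundary: the honest sequence of point blow-ups of the surface `S`
at the walk's centres.  DEFINITION (new typed object). -/
def companion (W : ForcedWalk q s₀) (N s : ℕ) : ℕ → MvPolynomial (Fin 3) K
  | 0 => strip (W.st N)
  | n + 1 => translate (W.b (N + n)) (chartTransform s (W.j (N + n)) (companion W N s n))

/-- The companion recursion, restated. [folklore] -/
theorem companion_succ (W : ForcedWalk q s₀) (N s n : ℕ) :
    companion W N s (n + 1) = translate (W.b (N + n)) (chartTransform s (W.j (N + n)) (companion W N s n)) := rfl

end Companion

section Pieces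

/-- **DICTIONARY PIECE 1 — THE COMPANION LAW** (kernel algebra; PROVED in §N4 below as `companionLaw`):
along a δ-balanced plateau of shade `s`, the companion chain is NEAR — every `G_n` has multiplicity EXACTLY `s` at
the origin — and its tangent cone is the walk's residual cone: `in_{o_t}(F_t) = c_t · y^{r_t} · in_s(G_n)`,
`t = N + n`, `c_t ≠ 0` (the boundary unit).  Mechanism: `F_t = y^{r_t}·U_t·G_n + C_t` with `U_t(0) ≠ 0` and `C_t ∈
K[y^{p^e}]` (the accumulated cleanings), by multiplicativity of the chart transform and `K[y^{p^e}]` being stable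
under charts and translations in characteristic `p`; a `p^e`-th power cannot sit on two walls of height `δ` below
degree `2s`, which pins `ord G_n = s` from both sides.  DEFINITION (typed piece; its proof is `companionLaw`). -/
def CompanionLaw : Prop :=
  ∀ p : ℕ, p.Prime → ∀ e : ℕ, 2 ≤ e →
    ∀ (K : Type) [Field K] [CharP K p] [PerfectField K] [DecidableEq K] (s₀ : State (Fin 3) K),
      IsRoot (p ^ e) s₀ → ∀ W : ForcedWalk (p ^ e) s₀, ∀ N : ℕ,
      (∀ t, N ≤ t → (W.st (t + 1)).shade = (W.st t).shade) →
      (∀ t, N ≤ t → ordZero (W.st t).F ≠ ((p ^ e : ℕ) : ℕ∞)) →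
      ∀ s : ℕ, (W.st N).shade = (s : ℕ∞) → 2 ≤ s →
      (∀ t, N ≤ t → ((W.st t).r.degree + 2 * s = 2 * p ^ e ∧
        ∃ x, (W.st t).r x = 0 ∧ ∀ y, y ≠ x → (W.st t).r y + s = p ^ e)) →
      ∀ n : ℕ, ordZero (companion W N s n) = (s : ℕ∞) ∧
        ∃ c : K, c ≠ 0 ∧ homogeneousComponent ((W.st (N + n)).r.degree + s) (W.st (N + n)).F
          = C c * (monomial (W.st (N + n)).r 1 * homogeneousComponent s (companion W N s n))

/-- **DICTIONARY PIECE 2 — THE SHEDDING LEMMA** (named; REDUCED IN KERNEL by §N5 to its off-wall half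
`OffWallShedding` — `sheddingLemma_of_offWall`): along a δ-balanced plateau of shade `s` with recurring repeats,
from some stage on the origin is ISOLATED in the multiplicity-`s` locus of the companion surface `{G_n = 0}`.
Proof plan (NODE-g22.md §3): (a) WALL EXCLUSION — PROVED (`wallIsolation`, §N5): the threefold's own isolation
certificate `ForcedWalk.isolated` (origin isolated in `V(topIdeal q F_t)`) pushes through the structure
`F_t = y^{r_t} U_t G_n + C_t`, `C_t ∈ K[y^q]`: every Hasse derivative of order `< q` kills `C_t`, and by the higher
Leibniz rule `∂^{(α)}(y_w^δ · U G_n y_{w'}^δ) ∈ multIdeal s G_n + (y_w)` for `|α| < q = δ + s`; hence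
`topIdeal q F_t ⊆ multIdeal s G_n + (y_w)` for each of the two walls `w`, i.e. the order-`s` locus of `G_n` meets
each wall only at the origin (locally) — AT EVERY STAGE, no `m₀` needed; (b) OFF-WALL SHEDDING — the named prover
target `OffWallShedding` (§N5; one-page classical paper proof in NODE-g22.md §3: by (a) the order-`s` locus of
`G_n` is a finite union of curve branches through the origin lying in no wall; the walk follows a branch only while
its tangent is the next centre; the monovariant `Φ_n(γ) = i₀(γ, W₁) + i₀(γ, W₂)` (intersection numbers with the two
walls) drops by `mult₀(γ) ≥ 1` at every move, and new order-`s` branches are born only INSIDE the exceptional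
divisor, which is a wall — so after `≤ max Φ₀` moves no off-wall branch is left); (a) + (b) ⟹ isolation by the ideal
arithmetic `isolatedMult_of_walls`.  DEFINITION (typed piece; = `OffWallShedding` modulo kernel). -/
def SheddingLemma : Prop :=
  ∀ p : ℕ, p.Prime → ∀ e : ℕ, 2 ≤ e →
    ∀ (K : Type) [Field K] [CharP K p] [PerfectField K] [DecidableEq K] (s₀ : State (Fin 3) K),
      IsRoot (p ^ e) s₀ → ∀ W : ForcedWalk (p ^ e) s₀, ∀ N : ℕ,
      (∀ t, N ≤ t → (W.st (t + 1)).shade = (W.st t).shade) →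
      (∀ t, N ≤ t → ordZero (W.st t).F ≠ ((p ^ e : ℕ) : ℕ∞)) →
      (∀ M : ℕ, ∃ t, M ≤ t ∧ StaysOnNewest W t) →
      ∀ s : ℕ, (W.st N).shade = (s : ℕ∞) → 2 ≤ s →
      (∀ t, N ≤ t → ((W.st t).r.degree + 2 * s = 2 * p ^ e ∧
        ∃ x, (W.st t).r x = 0 ∧ ∀ y, y ≠ x → (W.st t).r y + s = p ^ e)) →
      ∃ m₀ : ℕ, ∀ n, m₀ ≤ n → IsolatedMult s (companion W N s n)

end Pieces

section Skeleton

/-! ### The composed skeleton (kernel-checked, 0 sorry): PORT + COMPANION LAW + DIRECTRIX LAW (§N1, proved) +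
SHEDDING LEMMA ⟹ the balanced-tail class. -/

/-- **`NoBalancedTailsDeep` MODULO THE PORT AND THE TWO DICTIONARY PIECES (PROVED composition).**  The companion
chain of a balanced tail, shifted past the shedding stage `m₀`, is an infinite NEAR chain with plane tangent cones
and isolated `s`-fold points — exactly what CJS Thm 5.40 forbids.  (`CompanionLaw` is PROVED below, so the net
residual hypotheses are `NearChainPort` + `SheddingLemma`; see `noBalancedTails_of_port`.) [new] [folklore] -/
theorem noBalancedTails_of_pieces (hP : NearChainPort) (hC : CompanionLaw) (hS : SheddingLemma) :
    NoBalancedTailsDeep := by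
  intro p hp e he K _ _ _ _ s₀ hroot W N hplat hbig hrec s hs h2 hbal
  classical
  -- shade is `s` all along the tail, orders are `> q`
  have hshade : ∀ t, N ≤ t → (W.st t).shade = (s : ℕ∞) := by
    intro t ht
    induction t, ht using Nat.le_induction with
    | base => exact hs
    | succ t ht ih => exact (hplat t ht).trans ih
  have hbig' : ∀ t, N ≤ t → p ^ e < ordZero (W.st t).F := by
    intro t ht
    have h1 := walk_ord hroot W t
    exact lt_of_le_of_ne h1 (fun h => hbig t ht h.symm)
  -- the pieces
  have hCW := hC p hp e he K s₀ hroot W N hplat hbig s hs h2 hbal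
  obtain ⟨m₀, hm₀⟩ := hS p hp e he K s₀ hroot W N hplat hbig hrec s hs h2 hbal
  -- the tangent cone of every companion stage is a pure `s`-th power of a non-zero linear form
  have hdir : ∀ n, ∃ (c : K) (ℓ : MvPolynomial (Fin 3) K), c ≠ 0 ∧ ℓ.IsHomogeneous 1 ∧ ℓ ≠ 0 ∧
      homogeneousComponent s (companion W N s n) = C c * ℓ ^ s := by
    intro n
    obtain ⟨hord, c₁, hc₁, hlay⟩ := hCW n
    obtain ⟨o, ho, -⟩ := walk_nat hroot W (N + n)
    obtain ⟨s', hs', hos⟩ := order_eq_shade_add_degree hroot W (N + n) ho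
    have hss : s' = s := by have h := hs'.symm.trans (hshade (N + n) (by omega)); exact_mod_cast h
    obtain ⟨c₂, ℓ, hc₂, hℓ1, hℓ0, hid⟩ :=
      directrix_of_plateau hroot W N hplat hbig' hrec hs (N + n) (by omega) o ho
    rw [show o = (W.st (N + n)).r.degree + s by omega, hlay] at hid
    -- cancel `C c₁ * y^r`
    have hyr : (monomial (W.st (N + n)).r (1 : K)) ≠ 0 := fun h => one_ne_zero (monomial_eq_zero.mp h)
    have h1 : monomial (W.st (N + n)).r (1 : K) * homogeneousComponent s (companion W N s n)
        = monomial (W.st (N + n)).r (1 : K) * (C (c₁⁻¹ * c₂) * ℓ ^ s) := by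
      have h : C c₁⁻¹ * (C c₁ * (monomial (W.st (N + n)).r (1 : K) * homogeneousComponent s (companion W N s n)))
          = C c₁⁻¹ * (C c₂ * (monomial (W.st (N + n)).r 1 * ℓ ^ s)) := by rw [hid]
      rw [← mul_assoc, ← map_mul, inv_mul_cancel₀ hc₁, map_one, one_mul] at h
      rw [h, map_mul]; ring
    exact ⟨c₁⁻¹ * c₂, ℓ, mul_ne_zero (inv_ne_zero hc₁) hc₂, hℓ1, hℓ0, mul_left_cancel₀ hyr h1⟩
  -- feed the SHIFTED companion chain to the port
  refine hP K s h2 (fun k => companion W N s (m₀ + k)) (fun k => W.j (N + (m₀ + k)))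
    (fun k => W.b (N + (m₀ + k))) (fun k => W.onExc _) (fun k => ?_) (fun k => (hCW (m₀ + k)).1)
    (fun k => hdir (m₀ + k)) (fun k => hm₀ (m₀ + k) (by omega))
  exact companion_succ W N s (m₀ + k)

end Skeleton

end Summit.ResolutionOfSingularities.ResolutionOfSingularities.Theorems.NearCut
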